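import Summits.MatrixMultiplication.MatrixMultiplication.Theorems.SaturationLadderHeightCeiling
import HarnessLib

/-!
# Route `SaturationLadder` on Strassen's spectrum, X: the crux AS A GERM OF LOW CLAUSES; the Hölder threshold is sharp

decomp-mm lens 1 «grading / quantitative ladder», gen 46, kernel K46-G/T (chain file 10, companion of file 9
`SaturationLadderHeightCeiling`).  Def-free, sorry-free support beneath the deciding crux `SubexpSaturation`
(stmt-MatrixMultiplication-25909) of `route-MatrixMultiplication-SaturationLadder`; cut of record UNCHANGED.
Notation as in files 7–9: `θ = specMMPoint K φ`, `d = θ₀+θ₁+θ₂−2`, height `θ₁`, depth `ε₂ = 1−θ₂`, `u = log(θ₁/ε₂)`,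
roof of the clause `(t, R)`: `t·θ₁ ≤ (1−θ₀) + R·ε₂`; the crux is the family `R = exp(c/(1−t))`, every `c > 0`, `t → 1`.

* §1 ★★★ `subexpSaturation_iff_lowRoof_of_rateBeyond` (over `ℂ`): under `RateBeyond θ` (route `FarEdgeDescent`) the
  crux is EQUIVALENT to its own restriction to the would-be violators profiled in file 9 — universal points that are off
  the face, DEEP (`Rε₂ < θ₁`), OUTSIDE THE CUSP (`θ₁^{1+δ₀} < ε₂`, any `δ₀ ≥ 1/θ`), of HEIGHT `θ₁ < R^{−θ}` and log-aspect
  `u > log R`: the crux in its OWN (clause) currency is a germ at the corner `(1,0,1)` of clauses owed only below the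
  height ceiling.  Headline form ★★ `subexpSaturation_iff_roofBelowCeiling_of_rateBeyond`: `SubexpSaturation ⟺` the
  roofs `(t, e^{c/(1−t)})` at the points of height `< exp(−θc/(1−t))` only; instances at the rate of record `θ = 13/29`
  (`…_record`, kernel XXX-C4 of route `FarEdgeDescent`) and ★ `violator_census_record`: the WANTED POSTER of a
  counterexample to the crux over `ℂ` (height `< R^{−13/29}`, outside the cusp of exponent `29/13`, deep, log-aspect in
  the window `(c/(1−t), c'/(1−t))` for every `c' > c₂ = (5 log(5/4)+3 log 2)/3`, darkness ratio `> 1−t`).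
* §2 ★ `holder_cusp_sharp` / ★ `holderCertifiesCusp_iff` (pure real analysis, answering the critic's K46-T): the
  Hölder-face mechanism of file 7 (`d ≤ B·ε₂^α ⟹` cusp law on `ε₂ ≤ θ₁^{1+δ}` when `α(1+δ) > 1`, `holder_cusp_bound`)
  is SHARP AS A MECHANISM: for `α(1+δ) ≤ 1` the real inequality `B·ε^α·log(θ/ε) ≤ κθ` FAILS on the cusp boundary
  `ε = θ^{1+δ}` at arbitrarily small heights, for every `κ`; hence, for `0 < α ≤ 1`, `δ > 0`, `B > 0`, the Hölder bound
  certifies the cusp of exponent `δ` for every rate `κ > 0` IFF `α(1+δ) > 1`.  (A statement about the METHOD's reach —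
  the threshold `δ = 1/α − 1`, i.e. `δ ≥ 1/θ` under `RateBeyond θ` — not about universal points.)

Nothing here proves `ω = 2` or an open item; no definitions (gate rule D-0009).  [cite: Strassen1988, Thm. 3.8]
[cite: LottiRomani1983, Prop. 4.1] [cite: CoppersmithWinograd1990, §8] [cite: Pan1984, Thm. 17.1]
[cite: AlmanLi2026, Proposition 4.2]
-/

set_option linter.dupNamespace false

noncomputable section

namespace Summit.MatrixMultiplication.MatrixMultiplication.Theorems.SaturationLadderClauseGerm

open Literature.Computability.AlgebraicComplexity
open Summit.MatrixMultiplication.MatrixMultiplication.Theses.SaturationLadder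
open Summit.MatrixMultiplication.MatrixMultiplication.Theorems.SaturationLadderCornerGerm
open Summit.MatrixMultiplication.MatrixMultiplication.Theorems.SaturationLadderCornerModulus
open Summit.MatrixMultiplication.MatrixMultiplication.Theorems.SaturationLadderCuspModulus
open Summit.MatrixMultiplication.MatrixMultiplication.Theorems.SaturationLadderHeightCeiling
open Summit.MatrixMultiplication.MatrixMultiplication.Theorems.FarEdgeDescentTowerLimit
  (rateBeyond_towerLimit rateBeyond_of_le_thirteen_twentyNinths)

variable {K : Type} [Field K]

/-! ## §1 The crux as a germ of low clauses (over `ℂ`) -/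

/-- **Cusp monotonicity**: for `0 < θ₁ ≤ 1` and `a ≤ b`, `θ₁^b < x ⟹ θ₁^a`-free form `θ₁^b ≤ θ₁^a`; used to pass
from the cusp exponent `1/θ` to any `δ₀ ≥ 1/θ`. [folklore] -/
theorem rpow_lt_of_rpow_lt_of_le {θ₁ a b x : ℝ} (h0 : 0 < θ₁) (h1 : θ₁ ≤ 1) (hab : a ≤ b)
    (h : θ₁ ^ a < x) : θ₁ ^ b < x :=
  lt_of_le_of_lt (Real.rpow_le_rpow_of_exponent_ge h0 h1 hab) h

/-- ★★★ **THE CRUX IS A GERM OF LOW CLAUSES** (over `ℂ`): if `RateBeyond θ` holds over `ℂ` (`θ > 0`: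
`∃ ρ > θ ∃ C ∀ k ≥ 1, ω(1,k,1) − (k+1) ≤ C·k^{−ρ}`) and `δ₀ ≥ 1/θ`, then `SubexpSaturation ⟺ ∀c>0 ∃t₀<1 ∀t∈[t₀,1)
∀φ universal/ℂ: [θ₂ < 1, θ₁ > 0, θ₁ < exp(−θc/(1−t)), θ₁^{1+δ₀} < 1−θ₂, exp(c/(1−t))(1−θ₂) < θ₁, u > c/(1−t)] ⟹
t·θ₁ ≤ (1−θ₀) + exp(c/(1−t))·(1−θ₂)` — the clause family of the crux is owed only at deep, non-cusp points BELOW THE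
HEIGHT CEILING `R^{−θ}`.  (⟹ file 4's `subexpSaturation_iff_roof`; ⟸ file 9's `violator_profile_of_rateBeyond`.)
[cite: Strassen1988, Thm. 3.8] [cite: LottiRomani1983, Prop. 4.1] [cite: Pan1984, Thm. 17.1] -/
theorem subexpSaturation_iff_lowRoof_of_rateBeyond {θ : ℝ} (hθ : 0 < θ)
    (hR : ∃ ρ C : ℝ, θ < ρ ∧ ∀ k : ℕ, 1 ≤ k → omegaRect ℂ 1 k 1 - (k + 1) ≤ C * (k : ℝ) ^ (-ρ))
    {δ₀ : ℝ} (hδ₀ : 1 / θ ≤ δ₀) :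
    SubexpSaturation ↔ ∀ c : ℝ, 0 < c → ∃ t₀ : ℝ, t₀ < 1 ∧ ∀ t : ℝ, t₀ ≤ t → t < 1 →
      ∀ F : SpectralMap ℂ, IsUniversalSpectralPoint ℂ F →
        specMMPoint ℂ F 2 < 1 → 0 < specMMPoint ℂ F 1 →
        specMMPoint ℂ F 1 < Real.exp (-(θ * c / (1 - t))) →
        specMMPoint ℂ F 1 ^ (1 + δ₀) < 1 - specMMPoint ℂ F 2 →
        Real.exp (c / (1 - t)) * (1 - specMMPoint ℂ F 2) < specMMPoint ℂ F 1 →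
        c / (1 - t) < Real.log (specMMPoint ℂ F 1 / (1 - specMMPoint ℂ F 2)) →
          t * specMMPoint ℂ F 1 ≤
            (1 - specMMPoint ℂ F 0) + Real.exp (c / (1 - t)) * (1 - specMMPoint ℂ F 2) := by
  rw [subexpSaturation_iff_roof]
  constructor
  · intro h c hc
    obtain ⟨t₀, ht₀, h0⟩ := h c hc
    exact ⟨t₀, ht₀, fun t ht ht1 F hF _ _ _ _ _ _ => h0 t ht ht1 F hF⟩
  · intro h c hc
    obtain ⟨t₀, ht₀, h0⟩ := h c hc
    obtain ⟨t₁, ht₁, hP⟩ := violator_profile_of_rateBeyond hθ hR hc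
    refine ⟨max t₀ t₁, max_lt ht₀ ht₁, fun t ht ht1 F hF => ?_⟩
    by_contra hnot
    obtain ⟨h2, hθ1, hdeep, hsh, hh, hu, -⟩ := hP t (le_trans (le_max_right _ _) ht) ht1 F hF hnot
    have hsh' := rpow_lt_of_rpow_lt_of_le (b := 1 + δ₀) hθ1 (AlmanLi2026.prop42_mem_Icc hF 1).2
      (by linarith) hsh
    exact hnot (h0 t (le_trans (le_max_left _ _) ht) ht1 F hF h2 hθ1 hh hsh' hdeep hu)

/-- ★★ **HEADLINE FORM**: under `RateBeyond θ` over `ℂ` (`θ > 0`), `SubexpSaturation ⟺ ∀c>0 ∃t₀<1 ∀t∈[t₀,1)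
∀φ universal/ℂ of height θ₁ < exp(−θc/(1−t)): t·θ₁ ≤ (1−θ₀) + exp(c/(1−t))·(1−θ₂)` — the length-`R` clause of the
crux need only be checked at universal points of height `< R^{−θ}`. [cite: Strassen1988, Thm. 3.8]
[cite: LottiRomani1983, Prop. 4.1] [cite: Pan1984, Thm. 17.1] -/
theorem subexpSaturation_iff_roofBelowCeiling_of_rateBeyond {θ : ℝ} (hθ : 0 < θ)
    (hR : ∃ ρ C : ℝ, θ < ρ ∧ ∀ k : ℕ, 1 ≤ k → omegaRect ℂ 1 k 1 - (k + 1) ≤ C * (k : ℝ) ^ (-ρ)) :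
    SubexpSaturation ↔ ∀ c : ℝ, 0 < c → ∃ t₀ : ℝ, t₀ < 1 ∧ ∀ t : ℝ, t₀ ≤ t → t < 1 →
      ∀ F : SpectralMap ℂ, IsUniversalSpectralPoint ℂ F →
        specMMPoint ℂ F 1 < Real.exp (-(θ * c / (1 - t))) →
          t * specMMPoint ℂ F 1 ≤
            (1 - specMMPoint ℂ F 0) + Real.exp (c / (1 - t)) * (1 - specMMPoint ℂ F 2) := by
  rw [subexpSaturation_iff_roof]
  constructor
  · intro h c hc
    obtain ⟨t₀, ht₀, h0⟩ := h c hc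
    exact ⟨t₀, ht₀, fun t ht ht1 F hF _ => h0 t ht ht1 F hF⟩
  · intro h c hc
    obtain ⟨t₀, ht₀, h0⟩ := h c hc
    obtain ⟨t₁, ht₁, hP⟩ := heightCeiling_of_rateBeyond hθ hR hc
    refine ⟨max t₀ t₁, max_lt ht₀ ht₁, fun t ht ht1 F hF => ?_⟩
    by_cases hh : specMMPoint ℂ F 1 < Real.exp (-(θ * c / (1 - t)))
    · exact h0 t (le_trans (le_max_left _ _) ht) ht1 F hF hh
    · exact hP t (le_trans (le_max_right _ _) ht) ht1 F hF (not_lt.1 hh)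

/-- ★★ **Instance at the rate of record** (`RateBeyond (13/29)` over `ℂ`, route `FarEdgeDescent` kernel XXX-C4):
`SubexpSaturation ⟺` the roofs `(t, R = e^{c/(1−t)})` at the universal points of height `θ₁ < R^{−13/29}` only.
[cite: Pan1984, Thm. 17.1] [cite: LottiRomani1983, Thm. 3.1, Prop. 4.1] [cite: Strassen1988, Thm. 3.8] -/
theorem subexpSaturation_iff_roofBelowCeiling_record :
    SubexpSaturation ↔ ∀ c : ℝ, 0 < c → ∃ t₀ : ℝ, t₀ < 1 ∧ ∀ t : ℝ, t₀ ≤ t → t < 1 →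
      ∀ F : SpectralMap ℂ, IsUniversalSpectralPoint ℂ F →
        specMMPoint ℂ F 1 < Real.exp (-(13 / 29 * c / (1 - t))) →
          t * specMMPoint ℂ F 1 ≤
            (1 - specMMPoint ℂ F 0) + Real.exp (c / (1 - t)) * (1 - specMMPoint ℂ F 2) :=
  subexpSaturation_iff_roofBelowCeiling_of_rateBeyond (by norm_num) (rateBeyond_of_le_thirteen_twentyNinths ℂ le_rfl)

/-- ★★ **Full profile at the rate of record**: `SubexpSaturation ⟺` the roofs `(t, e^{c/(1−t)})` at the universal
points over `ℂ` that are off the face, of positive height `< exp(−(13/29)c/(1−t))`, outside the cusp of exponent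
`29/13`, deep, and of log-aspect `> c/(1−t)`. [cite: Pan1984, Thm. 17.1] [cite: LottiRomani1983, Prop. 4.1]
[cite: Strassen1988, Thm. 3.8] -/
theorem subexpSaturation_iff_lowRoof_record :
    SubexpSaturation ↔ ∀ c : ℝ, 0 < c → ∃ t₀ : ℝ, t₀ < 1 ∧ ∀ t : ℝ, t₀ ≤ t → t < 1 →
      ∀ F : SpectralMap ℂ, IsUniversalSpectralPoint ℂ F →
        specMMPoint ℂ F 2 < 1 → 0 < specMMPoint ℂ F 1 →
        specMMPoint ℂ F 1 < Real.exp (-(13 / 29 * c / (1 - t))) →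
        specMMPoint ℂ F 1 ^ (1 + 29 / 13 : ℝ) < 1 - specMMPoint ℂ F 2 →
        Real.exp (c / (1 - t)) * (1 - specMMPoint ℂ F 2) < specMMPoint ℂ F 1 →
        c / (1 - t) < Real.log (specMMPoint ℂ F 1 / (1 - specMMPoint ℂ F 2)) →
          t * specMMPoint ℂ F 1 ≤
            (1 - specMMPoint ℂ F 0) + Real.exp (c / (1 - t)) * (1 - specMMPoint ℂ F 2) :=
  subexpSaturation_iff_lowRoof_of_rateBeyond (by norm_num) (rateBeyond_of_le_thirteen_twentyNinths ℂ le_rfl)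
    (by norm_num)

/-- ★ **At the tower's limiting order**: with `m*` the fixed point of route `FarEdgeDescent`'s box-tower map and
`λ* = 7(1−m*)^6/(1+g(m*))`, for EVERY `0 < θ < log₇λ*/(1−log₇λ*) = 0.4486…`: `SubexpSaturation ⟺` the roofs
`(t, R)` at the universal points over `ℂ` of height `< R^{−θ}` only. [cite: Pan1984, Thm. 17.1]
[cite: LottiRomani1983, Thm. 3.1, Prop. 4.1] -/
theorem subexpSaturation_iff_roofBelowCeiling_towerLimit :
    ∃ mstar : ℝ, (17461 : ℝ) / 100000 ≤ mstar ∧ mstar ≤ 174611 / 1000000 ∧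
      ((1 - mstar) ^ 7 - (1 - 2 * mstar) ^ 7) / (1 + ((1 - mstar) ^ 7 - (1 - 2 * mstar) ^ 7)) = mstar ∧
      ∀ θ : ℝ, 0 < θ →
        θ < Real.logb 7 (7 * (1 - mstar) ^ 6 / (1 + ((1 - mstar) ^ 7 - (1 - 2 * mstar) ^ 7))) /
          (1 - Real.logb 7 (7 * (1 - mstar) ^ 6 / (1 + ((1 - mstar) ^ 7 - (1 - 2 * mstar) ^ 7)))) →
        (SubexpSaturation ↔ ∀ c : ℝ, 0 < c → ∃ t₀ : ℝ, t₀ < 1 ∧ ∀ t : ℝ, t₀ ≤ t → t < 1 →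
          ∀ F : SpectralMap ℂ, IsUniversalSpectralPoint ℂ F →
            specMMPoint ℂ F 1 < Real.exp (-(θ * c / (1 - t))) →
              t * specMMPoint ℂ F 1 ≤
                (1 - specMMPoint ℂ F 0) + Real.exp (c / (1 - t)) * (1 - specMMPoint ℂ F 2)) := by
  obtain ⟨m, hm1, hm2, hfix, hrate⟩ := rateBeyond_towerLimit ℂ
  exact ⟨m, hm1, hm2, hfix, fun θ hθ hθlt =>
    subexpSaturation_iff_roofBelowCeiling_of_rateBeyond hθ (hrate θ hθlt)⟩

/-- ★ **WANTED POSTER of a counterexample to the crux over `ℂ`** (all certificates of record combined): for every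
`c > 0` and `c' > c₂ = (5 log(5/4) + 3 log 2)/3` there is `t₁ < 1` such that a universal `φ` over `ℂ` violating the
clause `(t, R = e^{c/(1−t)})`, `t ∈ [t₁,1)`, must have: `θ₂ < 1`; height `0 < θ₁ < R^{−13/29}`; `θ₁^{1+29/13} < 1−θ₂ <
θ₁/R` (outside the cusp, deep); log-aspect in the window `c/(1−t) < u < c'/(1−t)`; darkness `d > (1−t)θ₁`.
(Route `FarEdgeDescent`'s `RateBeyond (13/29)`, file 9's profile and window, file 3's law above `c₂`.)
[cite: Pan1984, Thm. 17.1] [cite: CoppersmithWinograd1990, §8] [cite: Strassen1988, Thm. 3.8] -/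
theorem violator_census_record {c c' : ℝ} (hc : 0 < c) (hc' : (5 * Real.log (5 / 4) + 3 * Real.log 2) / 3 < c') :
    ∃ t₁ : ℝ, t₁ < 1 ∧ ∀ t : ℝ, t₁ ≤ t → t < 1 → ∀ F : SpectralMap ℂ, IsUniversalSpectralPoint ℂ F →
      ¬ (t * specMMPoint ℂ F 1 ≤
          (1 - specMMPoint ℂ F 0) + Real.exp (c / (1 - t)) * (1 - specMMPoint ℂ F 2)) →
        specMMPoint ℂ F 2 < 1 ∧ 0 < specMMPoint ℂ F 1 ∧
          specMMPoint ℂ F 1 < Real.exp (-(13 / 29 * c / (1 - t))) ∧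
          specMMPoint ℂ F 1 ^ (1 + 29 / 13 : ℝ) < 1 - specMMPoint ℂ F 2 ∧
          Real.exp (c / (1 - t)) * (1 - specMMPoint ℂ F 2) < specMMPoint ℂ F 1 ∧
          c / (1 - t) < Real.log (specMMPoint ℂ F 1 / (1 - specMMPoint ℂ F 2)) ∧
          Real.log (specMMPoint ℂ F 1 / (1 - specMMPoint ℂ F 2)) < c' / (1 - t) ∧
          (1 - t) * specMMPoint ℂ F 1 < specMMPoint ℂ F 0 + specMMPoint ℂ F 1 + specMMPoint ℂ F 2 - 2 := by
  obtain ⟨t₁, ht₁, hP⟩ := violator_profile_of_rateBeyond (K := ℂ) (θ := 13 / 29) (by norm_num)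
    (rateBeyond_of_le_thirteen_twentyNinths ℂ le_rfl) hc
  obtain ⟨t₂, ht₂, hW⟩ := violator_window_classCeiling hc hc'
  refine ⟨max t₁ t₂, max_lt ht₁ ht₂, fun t ht ht1 F hF hnot => ?_⟩
  obtain ⟨h2, hθ1, hdeep, hsh, hh, hu, hd⟩ := hP t (le_trans (le_max_left _ _) ht) ht1 F hF hnot
  obtain ⟨-, hw⟩ := hW t (le_trans (le_max_right _ _) ht) ht1 F hF hnot
  have hsh' := rpow_lt_of_rpow_lt_of_le (b := (1 + 29 / 13 : ℝ)) hθ1 (AlmanLi2026.prop42_mem_Icc hF 1).2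
    (by norm_num) hsh
  exact ⟨h2, hθ1, hh, hsh', hdeep, hu, hw, hd⟩

/-! ## §2 The Hölder threshold `α(1+δ) > 1` of file 7 is sharp (pure real analysis) -/

/-- ★ **SHARPNESS OF THE HÖLDER CUSP MECHANISM**: if `α(1+δ) ≤ 1` (`B, δ > 0`), then for every rate `κ`, every
threshold `u₀` and every height bound `η > 0` there is a point ON THE CUSP BOUNDARY `ε = θ^{1+δ}` of height
`0 < θ < η`, `θ ≤ 1`, with log-aspect `u = log(θ/ε) = δ·log(1/θ) ≥ u₀` at which the Hölder bound `B·ε^α·u` EXCEEDS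
`κθ` — so `holder_cusp_bound`'s hypothesis `1 < α(1+δ)` cannot be weakened: `ε^α = θ^{α(1+δ)} ≥ θ` while `u → ∞`.
[folklore] [cite: LottiRomani1983, Prop. 4.1] -/
theorem holder_cusp_sharp {B α δ : ℝ} (hB : 0 < B) (hδ : 0 < δ) (hγ : α * (1 + δ) ≤ 1)
    (κ u₀ : ℝ) {η : ℝ} (hη : 0 < η) :
    ∃ θ ε u : ℝ, 0 < θ ∧ θ < η ∧ θ ≤ 1 ∧ 0 < ε ∧ ε = θ ^ (1 + δ) ∧ u = Real.log (θ / ε) ∧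
      u₀ ≤ u ∧ κ * θ < B * ε ^ α * u := by
  set M : ℝ := max (max u₀ 1) (κ / B + 1) with hMdef
  have hM1 : 1 ≤ M := le_trans (le_max_right _ _) (le_max_left _ _)
  have hMu : u₀ ≤ M := le_trans (le_max_left _ _) (le_max_left _ _)
  have hMκ : κ / B + 1 ≤ M := le_max_right _ _
  set θ : ℝ := min (η / 2) (Real.exp (-(M / δ))) with hθdef
  have hθpos : 0 < θ := lt_min (by linarith) (Real.exp_pos _)
  have hθη : θ < η := lt_of_le_of_lt (min_le_left _ _) (by linarith)
  have hθE : θ ≤ Real.exp (-(M / δ)) := min_le_right _ _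
  have hE1 : Real.exp (-(M / δ)) < 1 := by
    rw [Real.exp_lt_one_iff]
    have : 0 < M / δ := div_pos (by linarith) hδ
    linarith
  have hθ1 : θ ≤ 1 := (lt_of_le_of_lt hθE hE1).le
  set ε : ℝ := θ ^ (1 + δ) with hεdef
  have hεpos : 0 < ε := Real.rpow_pos_of_pos hθpos _
  have hu_eq : Real.log (θ / ε) = -(δ * Real.log θ) := by
    rw [Real.log_div hθpos.ne' hεpos.ne', hεdef, Real.log_rpow hθpos]
    ring
  have hlogθ : Real.log θ ≤ -(M / δ) := by
    have := (Real.log_le_log_iff hθpos (Real.exp_pos _)).2 hθE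
    rwa [Real.log_exp] at this
  have huM : M ≤ Real.log (θ / ε) := by
    rw [hu_eq]
    have h' : δ * Real.log θ ≤ -M :=
      calc δ * Real.log θ ≤ δ * (-(M / δ)) := mul_le_mul_of_nonneg_left hlogθ hδ.le
        _ = -M := by field_simp
    linarith
  refine ⟨θ, ε, Real.log (θ / ε), hθpos, hθη, hθ1, hεpos, hεdef, rfl, le_trans hMu huM, ?_⟩
  have hεα : θ ≤ ε ^ α := by
    rw [hεdef, ← Real.rpow_mul hθpos.le]
    calc θ = θ ^ (1 : ℝ) := (Real.rpow_one θ).symm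
      _ ≤ θ ^ ((1 + δ) * α) := Real.rpow_le_rpow_of_exponent_ge hθpos hθ1 (by linarith)
  have hupos : 0 < Real.log (θ / ε) := lt_of_lt_of_le (by linarith) huM
  have hκu : κ / B < Real.log (θ / ε) := by linarith
  have hκ' : κ < B * Real.log (θ / ε) := by
    have := (div_lt_iff₀ hB).1 hκu
    linarith
  calc κ * θ < B * Real.log (θ / ε) * θ := mul_lt_mul_of_pos_right hκ' hθpos
    _ = B * θ * Real.log (θ / ε) := by ring
    _ ≤ B * ε ^ α * Real.log (θ / ε) :=
        mul_le_mul_of_nonneg_right (mul_le_mul_of_nonneg_left hεα hB.le) hupos.le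

/-- ★ **THE HÖLDER BOUND CERTIFIES THE CUSP OF EXPONENT `δ` IFF `α(1+δ) > 1`** (`B > 0`, `0 < α ≤ 1`, `δ > 0`):
the real-variable certificate behind file 7's `cuspModulus_of_holderFace` — "for every rate `κ > 0` there is a height
`θ⋆ > 0` below which `B·ε^α·u ≤ κθ` for all `0 < ε ≤ θ^{1+δ}`, `u = log(θ/ε) > 0`" — holds exactly when `1 < α(1+δ)`
(⟸ `holder_cusp_bound`; ⟹ `holder_cusp_sharp`).  Under `RateBeyond θ'` (`α ↑ θ'/(1+θ')`) the certified cusps are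
exactly `δ > 1/θ'`⁻: the threshold of files 7/8 is a property of the mechanism, not an artefact of the proof.
[folklore] [cite: LottiRomani1983, Prop. 4.1] -/
theorem holderCertifiesCusp_iff {B α δ : ℝ} (hB : 0 < B) (hα : 0 < α) (hα1 : α ≤ 1) (hδ : 0 < δ) :
    (∀ κ : ℝ, 0 < κ → ∃ θs : ℝ, 0 < θs ∧ ∀ θ ε u : ℝ, 0 < θ → θ ≤ θs → 0 < ε → ε ≤ θ ^ (1 + δ) →
        u = Real.log (θ / ε) → 0 < u → B * ε ^ α * u ≤ κ * θ) ↔ 1 < α * (1 + δ) := by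
  constructor
  · intro h
    by_contra hle
    obtain ⟨θs, hθs, hall⟩ := h 1 one_pos
    obtain ⟨θ, ε, u, hθ, hθη, -, hε, hεeq, hu, hu1, hlt⟩ := holder_cusp_sharp hB hδ (not_lt.1 hle) 1 1 hθs
    have := hall θ ε u hθ hθη.le hε hεeq.le hu (by linarith)
    linarith
  · intro hγ κ hκ
    have hγ0 : 0 < α * (1 + δ) - 1 := by linarith
    refine ⟨(κ * ((α * (1 + δ) - 1) / (2 * δ)) / B) ^ (2 / (α * (1 + δ) - 1)),
      Real.rpow_pos_of_pos (div_pos (mul_pos hκ (div_pos hγ0 (by positivity))) hB) _, ?_⟩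
    intro θ ε u hθ hθs hε hcusp hu hu0
    exact holder_cusp_bound hB hα hα1 hγ hκ hθ hε hcusp hu hu0 hθs

end Summit.MatrixMultiplication.MatrixMultiplication.Theorems.SaturationLadderClauseGerm

end
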